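import Literature.NumberTheory.Sieve.QuadraticRootsPrimeModuliDFISieveRough
import HarnessLib

/-!
# Duke–Friedlander–Iwaniec 1995, §6: the error terms of Lemma 3 / Theorem 5 are `o(x/log x)`

Topic `Literature/NumberTheory/Sieve`.  Towards the discharge of
`Literature.NumberTheory.Sieve.dukeFriedlanderIwaniec1995_theorem5` (W. Duke, J. B. Friedlander,
H. Iwaniec, Ann. of Math. 141 (1995), §6 p. 437: "then all of the sums on the right-hand side of (31)
can be successfully bounded").  With the choices `w = x^{(log log x)^{−3}}`, `y = x^{1/3−ε}`,
`D = x^{1/2−ε}` (fixed by the statement), `z = x^{1/2−3ε/2}`, `K = ⌊log x⌋⁵`, every term of the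
master inequality `DFI1995.norm_primeSum_le_master` other than the two `O(εx/log x)` terms is at most
`ε x/log x` once `log x` exceeds an explicit threshold (depending on `ε` and on the constants
`A₁, A₂` of (34), (35)).  This file proves these elementary real-variable estimates:

* `z²`-terms: `2z + 6 + 8(z+1)² ≤ 40 x^{1−3ε} ≤ εx/log x` as soon as `log x ≤ (ε/40) x^{3ε}`
  (`DFI1995.junk_z_le`);
* the Rankin tails `X F(D) + 2XG F(D/z) ≤ 10e^{16} x/log² x` (`DFI1995.junk_tail_le`: the exponent
  `log(D/z)/log w = (ε/2)(log log x)³` beats every power of `log x`);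
* the crude pieces `X Δ₀ G(4 + 8G) ≤ 20592 x/log² x` (`DFI1995.junk_middle_le`: `1/w ≤ (log x)^{−4}` once
  `log x ≥ 4(log log x)⁴`, and `log(y/w)/K ≤ 32 (log x)^{−4}`);
* `K B₂`, `2B₁`, and the two Mertens windows (`DFI1995.junk_KB_le`, `DFI1995.junk_B1_le`,
  `DFI1995.junk_left_le`, `DFI1995.junk_window_le`, `DFI1995.log_window_z_le`).

Everything here is proved; the assembly is `…DFIProofs`.

## References

* W. Duke, J. B. Friedlander, H. Iwaniec, Ann. of Math. (2) 141 (1995), 423–441, §6 p. 437.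
  [cite: DukeFriedlanderIwaniec1995, §6 Lemma 3 and Theorem 5]
-/

namespace Literature.NumberTheory.Sieve

open scoped BigOperators
open Finset Real

namespace DFI1995

noncomputable section

/-! ### Elementary inequalities for `L = log x` -/

/-- `log L ≤ 2 √L` for `L ≥ 0`. [folklore] -/
theorem log_le_two_mul_sqrt {L : ℝ} (hL : 0 ≤ L) : Real.log L ≤ 2 * Real.sqrt L := by
  have h := Real.log_le_rpow_div hL (by norm_num : (0 : ℝ) < 1 / 2)
  rw [← Real.sqrt_eq_rpow] at h
  linarith

/-- `(log L)⁴ ≤ 4096 √L` for `L ≥ 1` (`log L ≤ 8 L^{1/8}`). [folklore] -/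
theorem log_pow_four_le {L : ℝ} (hL : 1 ≤ L) : Real.log L ^ 4 ≤ 4096 * Real.sqrt L := by
  have hL0 : 0 ≤ L := by linarith
  have h := Real.log_le_rpow_div hL0 (by norm_num : (0 : ℝ) < 1 / 8)
  have hlog0 : 0 ≤ Real.log L := Real.log_nonneg hL
  have h8 : Real.log L ≤ 8 * L ^ (1 / 8 : ℝ) := by linarith
  calc Real.log L ^ 4 ≤ (8 * L ^ (1 / 8 : ℝ)) ^ 4 := pow_le_pow_left₀ hlog0 h8 4
    _ = 4096 * (L ^ (1 / 8 : ℝ)) ^ (4 : ℕ) := by ring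
    _ = 4096 * Real.sqrt L := by
        rw [← Real.rpow_natCast, ← Real.rpow_mul hL0, Real.sqrt_eq_rpow]
        norm_num

/-- `4 (log L)⁴ ≤ L` for `L ≥ 16384²`. [folklore] -/
theorem four_mul_log_pow_four_le {L : ℝ} (hL : (16384 : ℝ) ^ 2 ≤ L) : 4 * Real.log L ^ 4 ≤ L := by
  have hL1 : 1 ≤ L := le_trans (by norm_num) hL
  have hs : (16384 : ℝ) ≤ Real.sqrt L := by
    rw [Real.le_sqrt (by norm_num) (by linarith)]; exact hL
  calc 4 * Real.log L ^ 4 ≤ 4 * (4096 * Real.sqrt L) := by linarith [log_pow_four_le hL1]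
    _ = 16384 * Real.sqrt L := by ring
    _ ≤ Real.sqrt L * Real.sqrt L := mul_le_mul_of_nonneg_right hs (Real.sqrt_nonneg L)
    _ = L := Real.mul_self_sqrt (by linarith)

/-- `L⁵/32 ≤ ⌊L⌋⁵ ≤ L⁵` for `L ≥ 2`. [folklore] -/
theorem floor_pow_five_bounds {L : ℝ} (hL : 2 ≤ L) :
    L ^ 5 / 32 ≤ (((⌊L⌋₊ ^ 5 : ℕ)) : ℝ) ∧ (((⌊L⌋₊ ^ 5 : ℕ)) : ℝ) ≤ L ^ 5 := by
  have hL0 : 0 ≤ L := by linarith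
  have hfl : (⌊L⌋₊ : ℝ) ≤ L := Nat.floor_le hL0
  have hfl' : L / 2 ≤ (⌊L⌋₊ : ℝ) := by
    have := Nat.lt_floor_add_one L; linarith
  push_cast
  constructor
  · calc L ^ 5 / 32 = (L / 2) ^ 5 := by ring
      _ ≤ (⌊L⌋₊ : ℝ) ^ 5 := pow_le_pow_left₀ (by linarith) hfl' 5
  · exact pow_le_pow_left₀ (Nat.cast_nonneg _) hfl 5

/-- `exp(−c (log L)³) ≤ (L⁸)⁻¹` when `c (log L)² ≥ 8`, `L ≥ 1`. [folklore] -/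
theorem exp_neg_mul_log_pow_three_le {L c : ℝ} (hL : 1 ≤ L) (hc : 8 ≤ c * Real.log L ^ 2) :
    Real.exp (-(c * Real.log L ^ 3)) ≤ (L ^ 8)⁻¹ := by
  have hL0 : 0 < L := by linarith
  have hlog0 : 0 ≤ Real.log L := Real.log_nonneg hL
  have h1 : 8 * Real.log L ≤ c * Real.log L ^ 3 := by
    have : c * Real.log L ^ 3 = (c * Real.log L ^ 2) * Real.log L := by ring
    rw [this]; exact mul_le_mul_of_nonneg_right hc hlog0
  calc Real.exp (-(c * Real.log L ^ 3)) ≤ Real.exp (-(8 * Real.log L)) := Real.exp_le_exp.2 (by linarith)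
    _ = (L ^ 8)⁻¹ := by
        rw [Real.exp_neg, show (8 : ℝ) * Real.log L = ((8 : ℕ) : ℝ) * Real.log L by norm_num,
          Real.exp_nat_mul, Real.exp_log hL0]

/-! ### The Mertens window at `z = x^{1/2 − 3ε/2}` -/

/-- With `L = log x ≥ 16`, `0 < ε ≤ 1/24`:
`log((L/2)/((1/2 − 3ε/2)L − log 2)) + 16/((1/2 − 3ε/2)L − log 2) ≤ 6ε + 67/L`. [folklore] -/
theorem log_window_z_le {ε L : ℝ} (hε : 0 < ε) (hε' : ε ≤ 1 / 24) (hL : 16 ≤ L) :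
    Real.log ((L / 2) / ((1 / 2 - 3 * ε / 2) * L - Real.log 2)) + 16 / ((1 / 2 - 3 * ε / 2) * L - Real.log 2) ≤
      6 * ε + 67 / L := by
  have hL0 : 0 < L := by linarith
  have hlog2 : Real.log 2 < 0.6931471808 := Real.log_two_lt_d9
  have hlog2' : 0 < Real.log 2 := Real.log_pos one_lt_two
  have hden : L / 4 ≤ (1 / 2 - 3 * ε / 2) * L - Real.log 2 := by nlinarith
  have hden0 : 0 < (1 / 2 - 3 * ε / 2) * L - Real.log 2 := by linarith
  set t : ℝ := 3 * ε + 2 * Real.log 2 / L with ht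
  have ht0 : 0 ≤ t := by positivity
  have h2L : 2 * Real.log 2 / L ≤ 2 * Real.log 2 / 16 :=
    div_le_div_of_nonneg_left (by positivity) (by norm_num) hL
  have ht1 : t ≤ 1 / 2 := by rw [ht]; nlinarith
  have hratio : (L / 2) / ((1 / 2 - 3 * ε / 2) * L - Real.log 2) = 1 / (1 - t) := by
    rw [ht]; field_simp; ring
  have h1 : Real.log ((L / 2) / ((1 / 2 - 3 * ε / 2) * L - Real.log 2)) ≤ 2 * t := by
    rw [hratio, one_div, Real.log_inv]
    exact neg_log_one_sub_le ht0 ht1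
  have h2 : 16 / ((1 / 2 - 3 * ε / 2) * L - Real.log 2) ≤ 64 / L := by
    rw [div_le_div_iff₀ hden0 hL0]; linarith
  have h3 : 2 * t ≤ 6 * ε + 3 / L := by
    rw [ht]
    have : 4 * Real.log 2 / L ≤ 3 / L := div_le_div_of_nonneg_right (by nlinarith) hL0.le
    have e : 2 * (3 * ε + 2 * Real.log 2 / L) = 6 * ε + 4 * Real.log 2 / L := by ring
    linarith
  have h4 : 3 / L + 64 / L = 67 / L := by rw [← add_div]; norm_num
  linarith

/-! ### The junk terms -/

/-- `log L ≥ 2` for `L ≥ 16`. [folklore] -/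
theorem two_le_log_of_sixteen_le {L : ℝ} (hL : 16 ≤ L) : 2 ≤ Real.log L := by
  have he : Real.exp 1 < 2.7182818286 := Real.exp_one_lt_d9
  have h2 : Real.exp 2 ≤ L := by
    have : Real.exp 2 = Real.exp 1 * Real.exp 1 := by rw [← Real.exp_add]; norm_num
    rw [this]; nlinarith [Real.exp_pos 1]
  calc (2 : ℝ) = Real.log (Real.exp 2) := (Real.log_exp 2).symm
    _ ≤ Real.log L := Real.log_le_log (Real.exp_pos 2) h2

/-- `2z + 6 + 8(z + 1)² ≤ ε x/log x` for `z = x^{1/2−3ε/2}` once `log x ≥ 16` and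
`log x ≤ (ε/40) x^{3ε}` (`0 < ε ≤ 1/24`). [folklore] -/
theorem junk_z_le {ε x : ℝ} (hε : 0 < ε) (hε' : ε ≤ 1 / 24) (hx : 1 < x) (hL : 16 ≤ Real.log x)
    (hlo : Real.log x ≤ ε / 40 * x ^ (3 * ε)) :
    2 * x ^ (1 / 2 - 3 * ε / 2) + 6 + 8 * (x ^ (1 / 2 - 3 * ε / 2) + 1) ^ 2 ≤ ε * (x / Real.log x) := by
  have hx0 : 0 < x := by linarith
  set L := Real.log x with hLdef
  have hL0 : 0 < L := by linarith
  set z := x ^ (1 / 2 - 3 * ε / 2) with hz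
  have hz1 : 1 ≤ z := Real.one_le_rpow hx.le (by linarith)
  have hz2 : z ^ 2 = x ^ (1 - 3 * ε) := by
    rw [hz, ← Real.rpow_natCast, ← Real.rpow_mul hx0.le]; norm_num; ring_nf
  have h40 : 2 * z + 6 + 8 * (z + 1) ^ 2 ≤ 40 * z ^ 2 := by nlinarith
  have hsplit : x ^ (1 - 3 * ε) * x ^ (3 * ε) = x := by
    rw [← Real.rpow_add hx0]; norm_num
  have hpos : 0 < x ^ (1 - 3 * ε) := Real.rpow_pos_of_pos hx0 _
  -- `40 L x^{1-3ε} ≤ ε x`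
  have hmain : 40 * L * x ^ (1 - 3 * ε) ≤ ε * x := by
    have h1 : 40 * L ≤ ε * x ^ (3 * ε) := by linarith
    calc 40 * L * x ^ (1 - 3 * ε) ≤ (ε * x ^ (3 * ε)) * x ^ (1 - 3 * ε) :=
          mul_le_mul_of_nonneg_right h1 hpos.le
      _ = ε * x := by rw [mul_assoc, mul_comm (x ^ (3 * ε)), hsplit]
  calc 2 * z + 6 + 8 * (z + 1) ^ 2 ≤ 40 * z ^ 2 := h40
    _ = 40 * x ^ (1 - 3 * ε) := by rw [hz2]
    _ = (40 * L * x ^ (1 - 3 * ε)) / L := by field_simp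
    _ ≤ (ε * x) / L := div_le_div_of_nonneg_right hmain hL0.le
    _ = ε * (x / L) := by ring

/-- **The Rankin tails are negligible**: with `L = log x ≥ 16`, `log w = L/(log L)³`,
`log D = (1/2 − ε)L`, `log z = (1/2 − 3ε/2)L`, `(ε log 2/2)(log L)² ≥ 8` and `L ≥ 10 e^{16}/ε`,
`X F(D) + 2 X G F(D/z) ≤ ε x/L` (`X = x(1 + L)`, `G = log L + 4`,
`F(E) = exp(−log 2 · log E/log w) · exp(4(log log w + 4))`). [cite: DukeFriedlanderIwaniec1995, §6 p. 437] -/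
theorem junk_tail_le {ε x w D z : ℝ} (hε : 0 < ε) (hε' : ε ≤ 1 / 24) (hx : 1 < x) (hL : 16 ≤ Real.log x)
    (hD0 : 0 < D) (hz0 : 0 < z)
    (hw : Real.log w = Real.log x / Real.log (Real.log x) ^ 3)
    (hD : Real.log D = (1 / 2 - ε) * Real.log x) (hz : Real.log z = (1 / 2 - 3 * ε / 2) * Real.log x)
    (hL2 : 8 ≤ Real.log 2 * ε / 2 * Real.log (Real.log x) ^ 2)
    (hbig : 10 * Real.exp 16 / ε ≤ Real.log x) :
    (x * (1 + Real.log x)) *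
        (Real.exp (-(Real.log 2 * Real.log D / Real.log w)) * Real.exp (4 * (Real.log (Real.log w) + 4))) +
      2 * (x * (1 + Real.log x)) * (Real.log (Real.log x) + 4) *
        (Real.exp (-(Real.log 2 * Real.log (D / z) / Real.log w)) * Real.exp (4 * (Real.log (Real.log w) + 4))) ≤
      ε * (x / Real.log x) := by
  have hx0 : 0 < x := by linarith
  set L := Real.log x with hLdef
  have hL0 : 0 < L := by linarith
  have hL1 : 1 ≤ L := by linarith
  set L₂ := Real.log L with hL₂def
  have hL₂2 : 2 ≤ L₂ := two_le_log_of_sixteen_le hL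
  have hL₂0 : 0 < L₂ := by linarith
  have hlog2 : 0 < Real.log 2 := Real.log_pos one_lt_two
  -- `log w = L/L₂³ > 0`
  have hlw : Real.log w = L / L₂ ^ 3 := hw
  have hlw0 : 0 < Real.log w := by rw [hlw]; positivity
  -- the two exponents
  have hE1 : Real.log D / Real.log w = (1 / 2 - ε) * L₂ ^ 3 := by
    rw [hD, hlw]; field_simp
  have hE2 : Real.log (D / z) / Real.log w = ε / 2 * L₂ ^ 3 := by
    rw [Real.log_div hD0.ne' hz0.ne', hD, hz, hlw]; field_simp; ring
  -- `exp(4(log log w + 4)) ≤ e^{16} L^4`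
  have hloglogw : Real.log (Real.log w) ≤ L₂ := by
    rw [hlw, Real.log_div hL0.ne' (by positivity), Real.log_pow]
    have : 0 ≤ Real.log L₂ := Real.log_nonneg (by linarith)
    push_cast
    linarith
  have hexp4 : Real.exp (4 * (Real.log (Real.log w) + 4)) ≤ Real.exp 16 * L ^ 4 := by
    calc Real.exp (4 * (Real.log (Real.log w) + 4)) ≤ Real.exp (4 * (L₂ + 4)) :=
          Real.exp_le_exp.2 (by linarith)
      _ = Real.exp 16 * L ^ 4 := by
          rw [show 4 * (L₂ + 4) = ((4 : ℕ) : ℝ) * L₂ + 16 by push_cast; ring, Real.exp_add,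
            Real.exp_nat_mul, hL₂def, Real.exp_log hL0]
          ring
  -- the decay factor
  have hdecay : Real.exp (-(Real.log 2 * ε / 2 * L₂ ^ 3)) ≤ (L ^ 8)⁻¹ :=
    exp_neg_mul_log_pow_three_le hL1 hL2
  have hF1 : Real.exp (-(Real.log 2 * Real.log D / Real.log w)) *
      Real.exp (4 * (Real.log (Real.log w) + 4)) ≤ (L ^ 8)⁻¹ * (Real.exp 16 * L ^ 4) := by
    refine mul_le_mul ?_ hexp4 (Real.exp_pos _).le (by positivity)
    refine le_trans (Real.exp_le_exp.2 ?_) hdecay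
    rw [mul_div_assoc, hE1, neg_le_neg_iff]
    have h3 : 0 ≤ L₂ ^ 3 := by positivity
    have key : Real.log 2 * ((1 / 2 - ε) * L₂ ^ 3) =
        Real.log 2 * ε / 2 * L₂ ^ 3 + (Real.log 2 * L₂ ^ 3) * (1 / 2 - 3 * ε / 2) := by ring
    rw [key]
    have : 0 ≤ (Real.log 2 * L₂ ^ 3) * (1 / 2 - 3 * ε / 2) :=
      mul_nonneg (mul_nonneg hlog2.le h3) (by linarith)
    linarith
  have hF2 : Real.exp (-(Real.log 2 * Real.log (D / z) / Real.log w)) *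
      Real.exp (4 * (Real.log (Real.log w) + 4)) ≤ (L ^ 8)⁻¹ * (Real.exp 16 * L ^ 4) := by
    refine mul_le_mul ?_ hexp4 (Real.exp_pos _).le (by positivity)
    refine le_trans (le_of_eq ?_) hdecay
    have e : Real.log 2 * Real.log (D / z) / Real.log w = Real.log 2 * ε / 2 * L₂ ^ 3 := by
      calc Real.log 2 * Real.log (D / z) / Real.log w = Real.log 2 * (Real.log (D / z) / Real.log w) :=
            mul_div_assoc _ _ _
        _ = Real.log 2 * (ε / 2 * L₂ ^ 3) := by rw [hE2]
        _ = Real.log 2 * ε / 2 * L₂ ^ 3 := by ring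
    rw [e]
  -- sizes
  set Fb : ℝ := (L ^ 8)⁻¹ * (Real.exp 16 * L ^ 4) with hFb
  have hFb0 : 0 ≤ Fb := by positivity
  have hFbval : Fb = Real.exp 16 / L ^ 4 := by
    rw [hFb]; field_simp
  have hX : x * (1 + L) ≤ 2 * x * L := by nlinarith
  have hX0 : 0 ≤ x * (1 + L) := by positivity
  have hG : L₂ + 4 ≤ 2 * L := by
    have := Real.log_le_sub_one_of_pos hL0; rw [← hL₂def] at this; linarith
  have hG0 : 0 ≤ L₂ + 4 := by linarith
  calc (x * (1 + L)) * (Real.exp (-(Real.log 2 * Real.log D / Real.log w)) *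
          Real.exp (4 * (Real.log (Real.log w) + 4))) +
        2 * (x * (1 + L)) * (L₂ + 4) *
          (Real.exp (-(Real.log 2 * Real.log (D / z) / Real.log w)) * Real.exp (4 * (Real.log (Real.log w) + 4)))
      ≤ (x * (1 + L)) * Fb + 2 * (x * (1 + L)) * (L₂ + 4) * Fb := by
        refine add_le_add (mul_le_mul_of_nonneg_left hF1 hX0) ?_
        exact mul_le_mul_of_nonneg_left hF2 (by positivity)
    _ ≤ (2 * x * L) * Fb + 2 * (2 * x * L) * (2 * L) * Fb := by
        have h1 : (x * (1 + L)) * Fb ≤ (2 * x * L) * Fb := mul_le_mul_of_nonneg_right hX hFb0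
        have h2 : 2 * (x * (1 + L)) * (L₂ + 4) * Fb ≤ 2 * (2 * x * L) * (2 * L) * Fb := by
          have := mul_le_mul hX hG hG0 (by positivity)
          nlinarith
        linarith
    _ = Fb * (2 * x * L + 8 * x * L ^ 2) := by ring
    _ ≤ Fb * (10 * x * L ^ 2) := by
        refine mul_le_mul_of_nonneg_left ?_ hFb0
        nlinarith [mul_nonneg hx0.le hL0.le]
    _ = (10 * Real.exp 16 / L) * (x / L) := by rw [hFbval]; field_simp
    _ ≤ ε * (x / L) := by
        refine mul_le_mul_of_nonneg_right ?_ (by positivity)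
        rw [div_le_iff₀ hL0]
        have := (div_le_iff₀ hε).1 hbig
        linarith

/-- **The crude pieces are negligible**: with `L = log x ≥ 16384²`, `L ≥ 20592/ε`,
`log w = L/(log L)³`, `log y = (1/3 − ε)L`, `K = ⌊L⌋⁵`:
`X Δ₀ G (4 + 8G) ≤ ε x/L` (`Δ₀ = 1/w + log(y/w)/K`: `1/w ≤ L^{−4}`, `log(y/w)/K ≤ 32 L^{−4}`,
`G(4 + 8G) ≤ 312 L`). [cite: DukeFriedlanderIwaniec1995, §6 p. 437] -/
theorem junk_middle_le {ε x w y : ℝ} {K : ℕ} (hε : 0 < ε) (hε' : ε ≤ 1 / 24) (hx : 1 < x)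
    (hbig1 : (16384 : ℝ) ^ 2 ≤ Real.log x) (hbig2 : 20592 / ε ≤ Real.log x) (hw0 : 0 < w) (hy0 : 0 < y)
    (hw : Real.log w = Real.log x / Real.log (Real.log x) ^ 3)
    (hy : Real.log y = (1 / 3 - ε) * Real.log x) (hK : K = ⌊Real.log x⌋₊ ^ 5) :
    (x * (1 + Real.log x)) * (w⁻¹ + Real.log (y / w) / K) * (Real.log (Real.log x) + 4) *
        (4 + 8 * (Real.log (Real.log x) + 4)) ≤ ε * (x / Real.log x) := by
  have hx0 : 0 < x := by linarith
  set L := Real.log x with hLdef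
  have hL16 : 16 ≤ L := le_trans (by norm_num) hbig1
  have hL0 : 0 < L := by linarith
  have hL1 : 1 ≤ L := by linarith
  set L₂ := Real.log L with hL₂def
  have hL₂2 : 2 ≤ L₂ := two_le_log_of_sixteen_le hL16
  have hL₂0 : 0 < L₂ := by linarith
  -- `1/w ≤ L^{-4}`
  have hlw : Real.log w = L / L₂ ^ 3 := hw
  have h4 : 4 * L₂ ^ 4 ≤ L := four_mul_log_pow_four_le hbig1
  have hwinv : w⁻¹ ≤ (L ^ 4)⁻¹ := by
    have h1 : w⁻¹ = Real.exp (-(L / L₂ ^ 3)) := by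
      rw [Real.exp_neg, ← hlw, Real.exp_log hw0]
    have h2 : (L ^ 4)⁻¹ = Real.exp (-(((4 : ℕ) : ℝ) * L₂)) := by
      rw [Real.exp_neg, Real.exp_nat_mul, hL₂def, Real.exp_log hL0]
    rw [h1, h2, Real.exp_le_exp, neg_le_neg_iff]
    push_cast
    rw [le_div_iff₀ (by positivity)]
    nlinarith
  -- `log(y/w)/K ≤ 32 L^{-4}`
  obtain ⟨hKlow, -⟩ := floor_pow_five_bounds (by linarith : (2 : ℝ) ≤ L)
  have hKpos : (0 : ℝ) < ((⌊L⌋₊ ^ 5 : ℕ) : ℝ) := lt_of_lt_of_le (by positivity) hKlow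
  have hlogyw : Real.log (y / w) ≤ L := by
    rw [Real.log_div hy0.ne' hw0.ne', hy, hlw]
    have : 0 ≤ L / L₂ ^ 3 := by positivity
    nlinarith
  have hlogyw0 : 0 ≤ Real.log (y / w) := by
    rw [Real.log_div hy0.ne' hw0.ne', hy, hlw, sub_nonneg, div_le_iff₀ (by positivity)]
    -- `L ≤ (1/3 - ε) L L₂³` since `L₂³ ≥ 8`
    have h8 : (8 : ℝ) ≤ L₂ ^ 3 := by
      have := pow_le_pow_left₀ (by norm_num : (0 : ℝ) ≤ 2) hL₂2 3
      norm_num at this; exact this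
    have h7 : (1 : ℝ) ≤ (1 / 3 - ε) * L₂ ^ 3 := by
      have := mul_nonneg (sub_nonneg.2 hε') (by linarith : (0 : ℝ) ≤ L₂ ^ 3 - 8)
      nlinarith
    nlinarith [mul_le_mul_of_nonneg_left h7 hL0.le]
  have hΔ : w⁻¹ + Real.log (y / w) / K ≤ 33 * (L ^ 4)⁻¹ := by
    have h1 : Real.log (y / w) / (K : ℝ) ≤ L / (L ^ 5 / 32) := by
      rw [hK]
      calc Real.log (y / w) / (((⌊L⌋₊ ^ 5 : ℕ)) : ℝ) ≤ L / (((⌊L⌋₊ ^ 5 : ℕ)) : ℝ) :=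
            div_le_div_of_nonneg_right hlogyw hKpos.le
        _ ≤ L / (L ^ 5 / 32) := div_le_div_of_nonneg_left hL0.le (by positivity) hKlow
    have h2 : L / (L ^ 5 / 32) = 32 * (L ^ 4)⁻¹ := by field_simp
    linarith
  have hΔ0 : 0 ≤ w⁻¹ + Real.log (y / w) / K := by
    have : 0 ≤ Real.log (y / w) / (K : ℝ) := div_nonneg hlogyw0 (Nat.cast_nonneg _)
    positivity
  -- `G (4 + 8G) ≤ 312 L`
  have hsqrt1 : 1 ≤ Real.sqrt L := by rw [Real.le_sqrt (by norm_num) hL0.le]; linarith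
  have hG : L₂ + 4 ≤ 6 * Real.sqrt L := by
    have := log_le_two_mul_sqrt hL0.le; rw [← hL₂def] at this; linarith
  have hG' : 4 + 8 * (L₂ + 4) ≤ 52 * Real.sqrt L := by linarith
  have hG0 : 0 ≤ L₂ + 4 := by linarith
  have hGG : (L₂ + 4) * (4 + 8 * (L₂ + 4)) ≤ 312 * L := by
    calc (L₂ + 4) * (4 + 8 * (L₂ + 4)) ≤ (6 * Real.sqrt L) * (52 * Real.sqrt L) :=
          mul_le_mul hG hG' (by linarith) (by positivity)
      _ = 312 * L := by rw [show (6 * Real.sqrt L) * (52 * Real.sqrt L) = 312 * (Real.sqrt L * Real.sqrt L) by ring,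
          Real.mul_self_sqrt hL0.le]
  -- `X ≤ 2 x L`
  have hX : x * (1 + L) ≤ 2 * x * L := by nlinarith
  have hX0 : 0 ≤ x * (1 + L) := by positivity
  calc (x * (1 + L)) * (w⁻¹ + Real.log (y / w) / K) * (L₂ + 4) * (4 + 8 * (L₂ + 4))
      = (x * (1 + L)) * (w⁻¹ + Real.log (y / w) / K) * ((L₂ + 4) * (4 + 8 * (L₂ + 4))) := by ring
    _ ≤ (2 * x * L) * (33 * (L ^ 4)⁻¹) * (312 * L) := by
        refine mul_le_mul (mul_le_mul hX hΔ hΔ0 (by positivity)) hGG (by positivity) (by positivity)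
    _ = (20592 / L) * (x / L) := by field_simp; ring
    _ ≤ ε * (x / L) := by
        refine mul_le_mul_of_nonneg_right ?_ (by positivity)
        rw [div_le_iff₀ hL0]
        have := (div_le_iff₀ hε).1 hbig2
        linarith

/-- `K B₂ = ⌊L⌋⁵ · A₂ x/L^{10} ≤ ε x/L` once `L ≥ 2` and `L ≥ |A₂|/ε`. [folklore] -/
theorem junk_KB_le {ε x A₂ : ℝ} (hε : 0 < ε) (hx : 0 ≤ x) {L : ℝ} (hL : 2 ≤ L) (hA : |A₂| / ε ≤ L) :
    (((⌊L⌋₊ ^ 5 : ℕ)) : ℝ) * (A₂ * x / L ^ 10) ≤ ε * (x / L) := by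
  have hL0 : 0 < L := by linarith
  obtain ⟨-, hKle⟩ := floor_pow_five_bounds hL
  have hK0 : (0 : ℝ) ≤ (((⌊L⌋₊ ^ 5 : ℕ)) : ℝ) := Nat.cast_nonneg _
  have hA' : |A₂| ≤ ε * L := by
    have := (div_le_iff₀ hε).1 hA; linarith
  have hL4 : L ≤ L ^ 4 := by
    calc L = L ^ 1 := (pow_one L).symm
      _ ≤ L ^ 4 := pow_le_pow_right₀ (by linarith) (by norm_num)
  calc (((⌊L⌋₊ ^ 5 : ℕ)) : ℝ) * (A₂ * x / L ^ 10) ≤ (((⌊L⌋₊ ^ 5 : ℕ)) : ℝ) * (|A₂| * x / L ^ 10) := by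
        refine mul_le_mul_of_nonneg_left ?_ hK0
        refine div_le_div_of_nonneg_right (mul_le_mul_of_nonneg_right (le_abs_self A₂) hx) (by positivity)
    _ ≤ L ^ 5 * (|A₂| * x / L ^ 10) := mul_le_mul_of_nonneg_right hKle (by positivity)
    _ = (|A₂| / L ^ 4) * (x / L) := by field_simp
    _ ≤ ε * (x / L) := by
        refine mul_le_mul_of_nonneg_right ?_ (by positivity)
        rw [div_le_iff₀ (by positivity)]
        nlinarith

/-- `2B₁ = 2 A₁ x/L² ≤ ε x/L` once `L ≥ 2|A₁|/ε`. [folklore] -/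
theorem junk_B1_le {ε x A₁ L : ℝ} (hε : 0 < ε) (hx : 0 ≤ x) (hL0 : 0 < L) (hA : 2 * |A₁| / ε ≤ L) :
    2 * (A₁ * x / L ^ 2) ≤ ε * (x / L) := by
  have hA' : 2 * |A₁| ≤ ε * L := by
    have := (div_le_iff₀ hε).1 hA; linarith
  calc 2 * (A₁ * x / L ^ 2) ≤ 2 * (|A₁| * x / L ^ 2) := by
        refine mul_le_mul_of_nonneg_left ?_ (by norm_num)
        exact div_le_div_of_nonneg_right (mul_le_mul_of_nonneg_right (le_abs_self A₁) hx) (by positivity)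
    _ = (2 * |A₁| / L) * (x / L) := by field_simp
    _ ≤ ε * (x / L) := by
        refine mul_le_mul_of_nonneg_right ?_ (by positivity)
        rwa [div_le_iff₀ hL0]

/-- The left-alone bound: `160 (x/L)(12ε + 64/L)(6ε + 133/L) ≤ 961 ε x/L` once `L ≥ 128`,
`L ≥ 21280/ε` (`ε ≤ 1/24`). [folklore] -/
theorem junk_left_le {ε x L : ℝ} (hε : 0 < ε) (hε' : ε ≤ 1 / 24) (hx : 0 ≤ x) (hL : 128 ≤ L)
    (hL' : 21280 / ε ≤ L) :
    160 * (x / L) * (12 * ε + 64 / L) * (6 * ε + 133 / L) ≤ 961 * ε * (x / L) := by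
  have hL0 : 0 < L := by linarith
  have h1 : 12 * ε + 64 / L ≤ 1 := by
    have : 64 / L ≤ 64 / 128 := div_le_div_of_nonneg_left (by norm_num) (by norm_num) hL
    linarith
  have h2 : 0 ≤ 6 * ε + 133 / L := by positivity
  have h3 : 133 / L ≤ ε / 160 := by
    rw [div_le_iff₀ hL0]
    have := (div_le_iff₀ hε).1 hL'
    nlinarith
  have hxL : 0 ≤ x / L := by positivity
  calc 160 * (x / L) * (12 * ε + 64 / L) * (6 * ε + 133 / L)
      ≤ 160 * (x / L) * 1 * (6 * ε + 133 / L) := by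
        refine mul_le_mul_of_nonneg_right (mul_le_mul_of_nonneg_left h1 (by positivity)) h2
    _ ≤ 160 * (x / L) * 1 * (6 * ε + ε / 160) := by
        refine mul_le_mul_of_nonneg_left (by linarith) (by positivity)
    _ = 961 * ε * (x / L) := by ring

/-- The window remainder: `40 (x/L)(6ε + 67/L) ≤ 241 ε x/L` once `L ≥ 2680/ε`. [folklore] -/
theorem junk_window_le {ε x L : ℝ} (hε : 0 < ε) (hx : 0 ≤ x) (hL0 : 0 < L) (hL : 2680 / ε ≤ L) :
    40 * (x / L) * (6 * ε + 67 / L) ≤ 241 * ε * (x / L) := by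
  have h1 : 67 / L ≤ ε / 40 := by
    rw [div_le_iff₀ hL0]
    have := (div_le_iff₀ hε).1 hL
    nlinarith
  have hxL : 0 ≤ x / L := by positivity
  calc 40 * (x / L) * (6 * ε + 67 / L) ≤ 40 * (x / L) * (6 * ε + ε / 40) :=
        mul_le_mul_of_nonneg_left (by linarith) (by positivity)
    _ = 241 * ε * (x / L) := by ring

end

end DFI1995

end Literature.NumberTheory.Sieve
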